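import Summits.BirchSwinnertonDyer.BirchSwinnertonDyer.Theorems.Rank2Observatory2DescClCurveCertE2
import Summits.BirchSwinnertonDyer.BirchSwinnertonDyer.Theorems.Rank2Observatory2DescKillList
import HarnessLib

/-!
# BirchSwinnertonDyer — rank ≥ 2 observatory: KERNEL-2DESC-CL v2.7 — the TWO-VIEW per-curve certificate WITH A KILL LIST (complex case), part 1/2: records and checkers

HONEST FRAMING: per-curve certified theorems and census instruments; no claim on BSD in rank ≥ 2.

Part 1 of 2 (split at the 400-line module cap).  The two-view per-curve checker `checkE2 F cc r`
(`Rank2Observatory2DescClCurveCertE2*`, v2.3) bounds `rank E(ℚ)` by `r` when AT MOST `2^r` classes `(T, U)` of the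
`T`-unit family pass the sieve `adm2` (residues, sign, valuation parity at `W₁, W₂`).  For the even-class-number
non-monogenic fields of the census a large block of rank-2 curves has EIGHT admissible classes — rank bound 3.  The
v2.7 layer grafts the v1.3a/v2.5 KILL LAYER onto the two-view format, with no new residue arithmetic:

* `ClKillE2 = (U, p, fuel)` names a class `U` of the two-view family `fam2 cc`, a prime `p ∈ killPrimes` and a
  search depth; its representative `z = ∏_{j ∈ U} X_j` is multiplied out in `α`-coordinates from the `X = m₁·x`
  fields of the family entries (`ClKillE2.z`, via the landed `prodCoords`), and `killSearchE2` is the landed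
  residue-insolubility search `TwoDescKill.killCheck p a b c z t₁ t₂ fuel` at the `α`-coordinates `(t₁, t₂)` of
  `X_t = m₁·e` (already in the curve record) — `m₁ = r₁²` is a square, so no rescaling of the family is needed;
* `checkE2K F cc r ks` = the clauses of `checkE2 F cc r` except its count, verbatim, then the light kill clauses
  (`p ∈ killPrimes`, `z ≠ 0`, the class is not the trivial class) and FEWER THAN `2^(r+1)` classes pass
  `admE2K = admKills (adm2 F cc) kills`; the residue searches `killSearchE2 F cc ks` are a SEPARATE hypothesis of the
  soundness theorem (part 2, `rank_le_of_checkE2K`), decided monolithically (`by decide +kernel`) or assembled from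
  split certificates (`Rank2Observatory2DescKillSplit`, `Rank2Observatory2DescClKillCurveCertE2Rows`);
* `killListCheck_of_searchE2`, `noTrivial_of_liteE2`: the light clauses and the searches give the landed list
  certificate `killListCheck` (`Rank2Observatory2DescKillList`) and exclude the trivial class.

New declarations only; nothing landed is touched.  Sorry-free; axioms `propext`, `Classical.choice`, `Quot.sound`.
[cite: Cassels1991LecturesEllipticCurves, §15] [cite: CremonaAlgorithms1997, §3.6] [cite: Cohen1993, §4.8.2, §6.2, §6.5]
-/

set_option linter.dupNamespace false

noncomputable section

open scoped Classical NumberField nonZeroDivisors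

open Literature.NumberTheory.NumberFields Polynomial Module NumberField IsDedekindDomain Ideal

namespace Summit.BirchSwinnertonDyer.BirchSwinnertonDyer.Rank2Observatory.TwoDescCl

open TwoDescCubic ClFieldCert TwoDescKill

/-! ## Kill records over the two-view family -/

/-- **A raw kill** of a two-view row: the class `U` (indices into `fam2 cc`, no unit part), the kill prime
`p` and the search fuel (`depth − 1`). Pure data. [folklore] -/
structure ClKillE2 where
  /-- the class (indices into `fam2 cc`) -/
  U : List ℕ
  /-- the kill prime -/
  p : ℕ
  /-- search fuel of `killCheck` -/
  fuel : ℕ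

section Checkers

variable (F : ClFieldCertE2) (cc : ClCurveCertE2)

/-- `α`-coordinates of `X_j = m₁ · x_j` for the members of the two-view family, as a `Fin`-family. [folklore] -/
def famCoordsE2 : Fin (fam2 cc).length → ℤ × ℤ × ℤ := fun j => ((fam2 cc).get j).X

/-- The empty unit-coordinate family (the two-view format lists no separate units). [folklore] -/
def unitCoordsE2 : Fin 0 → ℤ × ℤ × ℤ := fun i => i.elim0

/-- The class of a raw kill as a `Finset` of family indices. [folklore] -/
def ClKillE2.cls (k : ClKillE2) : Finset (Fin (fam2 cc).length) :=
  Finset.univ.filter fun j : Fin (fam2 cc).length => j.val ∈ k.U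

/-- The representative `z = ∏_{j ∈ U} X_j` of a killed class in `α`-coordinates (multiplied out by the landed
`prodCoords`, so `killListCheck`'s product clause holds by evaluation). [folklore] -/
def ClKillE2.z (k : ClKillE2) : ℤ × ℤ × ℤ :=
  prodCoords F.fe.base.a F.fe.base.b F.fe.base.c unitCoordsE2 (famCoordsE2 cc) ∅ (k.cls cc)

/-- A raw kill as a `KillEntry` over the family coordinates. [folklore] -/
def ClKillE2.toEntry (k : ClKillE2) : KillEntry 0 (fam2 cc).length := ⟨∅, k.cls cc, k.z F cc, k.p, k.fuel⟩

/-- The kill list of a row as `KillEntry`s. [folklore] -/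
def killEntriesE2 (ks : List ClKillE2) : List (KillEntry 0 (fam2 cc).length) := ks.map (ClKillE2.toEntry F cc)

/-- The sieve of a v2.7 row: `adm2 F cc` minus the killed classes. [folklore] -/
def admE2K (ks : List ClKillE2) : Finset (Fin 0) → Finset (Fin (fam2 cc).length) → Bool :=
  admKills (adm2 F cc) (killEntriesE2 F cc ks)

/-- **Light kill clause** of one raw kill: `p ∈ killPrimes`, `z ≠ 0`, and the class is not the trivial class.
Computable. [folklore] -/
def ClKillE2.lite (k : ClKillE2) : Bool :=
  decide (k.p ∈ killPrimes) && decide (k.z F cc ≠ ((0 : ℤ), (0 : ℤ), (0 : ℤ))) && decide (k.cls cc ≠ ∅)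

/-- **The residue searches** of a kill list: `killCheck p a b c z t₁ t₂ fuel` for every raw kill, at the
`α`-coordinates `(t₁, t₂)` of `X_t = m₁ · e`.  Decided monolithically or assembled from split certificates.
[cite: CremonaAlgorithms1997, §3.6] -/
def killSearchE2 (ks : List ClKillE2) : Bool :=
  ks.all fun k => killCheck k.p F.fe.base.a F.fe.base.b F.fe.base.c (k.z F cc) cc.Xt.2.1 cc.Xt.2.2 k.fuel

/-- **The two-view per-curve `r`-checker with a kill list**: the clauses of `checkE2 F cc r` except its count,
verbatim; the light kill clauses; FEWER THAN `2^(r+1)` classes pass `admE2K`.  Computable; run by `decide +kernel`.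
[cite: Cassels1991LecturesEllipticCurves, §15] [cite: CremonaAlgorithms1997, §3.6] -/
def checkE2K (r : ℕ) (ks : List ClKillE2) : Bool :=
  decide (deltaShort cc.A cc.B cc.C ≠ 0) &&
    noRootMod cc.pF cc.A cc.B cc.C &&
    decide (cubicAtCoords F.fe.base.a F.fe.base.b F.fe.base.c ((F.m₁ : ℤ) * cc.A) ((F.m₁ : ℤ) ^ 2 * cc.B)
      ((F.m₁ : ℤ) ^ 3 * cc.C) cc.Xt = (0, 0, 0)) &&
    decide (derivAtCoords F.fe.base.a F.fe.base.b F.fe.base.c ((F.m₁ : ℤ) * cc.A) ((F.m₁ : ℤ) ^ 2 * cc.B) cc.Xt =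
      MonicCubic.mulCoords F.fe.base.a F.fe.base.b F.fe.base.c (smulCoords (F.m₁ : ℤ) cc.XD)
        (prodPowCoords F.fe.base.a F.fe.base.b F.fe.base.c [])) &&
    twoViewCheck F.fe.base.a F.fe.base.b F.fe.base.c F.fe.u F.fe.d F.m₁ F.m₂ cc.Xt cc.Yt &&
    twoViewCheck F.fe.base.a F.fe.base.b F.fe.base.c F.fe.u F.fe.d F.m₁ F.m₂ cc.XD cc.YD &&
    decide (MonicCubic.disc cc.A cc.B cc.C < 0) &&
    decide (normFormZ F.fe.base.a F.fe.base.b F.fe.base.c cc.XD.1 cc.XD.2.1 cc.XD.2.2 ≠ 0) &&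
    decide ((normFormZ F.fe.base.a F.fe.base.b F.fe.base.c cc.XD.1 cc.XD.2.1 cc.XD.2.2).natAbs =
      (cc.dn.map fun pe => pe.1 ^ pe.2).prod) &&
    (cc.dn.all fun pe => primeDispatch F cc cc.XD cc.YD cc.dinvA cc.dinvE pe.1) &&
    (cc.codes.all fun bc => codeClause F cc bc) &&
    invCert F.fe.base.a F.fe.base.b F.fe.base.c F.fe.base.w₁ cc.XD cc.dW1 &&
    invCert F.fe.base.a F.fe.base.b F.fe.base.c F.fe.base.w₂ cc.XD cc.dW2 &&
    (cc.Q.all fun q => decide (0 < q)) &&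
    decide (cc.head.length = 4) &&
    ((fam2 cc).all fun f => famCheckE2 F cc f) &&
    decide (∀ T : Finset (Fin (fam2 cc).length), T ≠ ∅ →
      ∃ k : Fin (F.fe.base.chars.length + 3), Odd (T.filter fun j => bit2 F cc k j = true).card) &&
    (ks.all fun k => k.lite F cc) &&
    decide (((Finset.univ ×ˢ Finset.univ).filter
      (fun p : Finset (Fin 0) × Finset (Fin (fam2 cc).length) => admE2K F cc ks p.1 p.2 = true)).card <
        2 ^ (r + 1))

variable {F cc}

/-- The light clauses and the residue searches give the landed list certificate `killListCheck` (the product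
clause holds by `rfl`). [folklore] -/
theorem killListCheck_of_searchE2 {ks : List ClKillE2} (hl : ∀ k ∈ ks, k.lite F cc = true)
    (hk : killSearchE2 F cc ks = true) :
    killListCheck F.fe.base.a F.fe.base.b F.fe.base.c cc.Xt.2.1 cc.Xt.2.2 unitCoordsE2 (famCoordsE2 cc)
      (killEntriesE2 F cc ks) = true := by
  rw [killSearchE2, List.all_eq_true] at hk
  rw [killListCheck, List.all_eq_true]
  intro e he
  obtain ⟨k, hkm, rfl⟩ := List.mem_map.mp he
  have h := hl k hkm
  simp only [ClKillE2.lite, Bool.and_eq_true, decide_eq_true_eq] at h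
  obtain ⟨⟨hp, hz⟩, -⟩ := h
  simp only [ClKillE2.toEntry, Bool.and_eq_true, decide_eq_true_eq]
  exact ⟨⟨⟨hp, rfl⟩, hz⟩, hk k hkm⟩

/-- No listed class is the trivial class. [folklore] -/
theorem noTrivial_of_liteE2 {ks : List ClKillE2} (hl : ∀ k ∈ ks, k.lite F cc = true) :
    ((killEntriesE2 F cc ks).all fun e => !(decide (e.T = ∅) && decide (e.U = ∅))) = true := by
  rw [List.all_eq_true]
  intro e he
  obtain ⟨k, hkm, rfl⟩ := List.mem_map.mp he
  have h := hl k hkm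
  simp only [ClKillE2.lite, Bool.and_eq_true, decide_eq_true_eq] at h
  simp [ClKillE2.toEntry, h.2]

end Checkers

end Summit.BirchSwinnertonDyer.BirchSwinnertonDyer.Rank2Observatory.TwoDescCl

end
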